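import Mathlib

/-!
# ζ(5) search — BARRIER: the finite core of the sharp cap `𝒩 ≤ 5` (kernel computation and its correctness)

HONEST FRAMING (cell `pub-zeta5`): systematic search; no irrationality claim unless kernel-certified. This file is pure finite
combinatorics (no reals); it serves `ConeGammaNCap5` (theory seat cert-2 g19, lead line 2026-08-23T13:25Z; memo
`cert-2/g18/NCAP5.md`, rank formulation `cert-2/g19/PLATEAU-THEORY.md`/`ncap_rank.py`). Nothing here is about `ζ(5)`.

SETTING. Vertices `0..6` (the seven coordinates `θ₁..θ₇` SORTED by fractional part). A *pattern* is `τ : List ℕ` with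
`heavy τ p q` (`p < q`) iff `τ[p] ≤ q`; the 64 DOUBLY MONOTONE patterns (`τ(p+1) ≤ max(τ(p), p+2)`, i.e. the threshold graphs
`{x_p + x_q ≥ 1}` of sorted weights) are the data `taus64`. The *high* set is a top segment `{v | 7 ≤ v + k}`. For a vertex
sequence `P`, `W P = #{heavy consecutive pairs} + #{high ends}` (`wVal`). CLAIM (checked by `decide +kernel` in eight chunks,
≈ 20 s each): for every pattern in `taus64` and every `k ≤ 7`, `max_P W − min_P W ≤ 5` over the Hamiltonian paths `P` of `{0..6}`.

* `picks`, `perms` — a STRUCTURALLY recursive enumeration of orderings (Mathlib's `List.permutations` does not reduce in the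
  kernel); `perms_complete` — every permutation of a list is enumerated.
* `endMaxMin`, `endTable`, `maxW`, `minW`, `checkTau`, `checkAll_eq_true` — the computation and its kernel certificate.
* **`wVal_sub_le_five_of_checkTau`** — if `checkTau τ = true` then `W P ≤ W P' + 5` for all orderings `P, P'` of `range 7`;
  **`checkTau_of_mem_taus64`**.
-/

namespace Summit.KontsevichZagierPeriods.Zeta5Search.Barrier.ConeGamma.NCap

/-! ### Data: the 64 doubly-monotone patterns -/

/-- patterns 0–7 -/
def tausC0 : List (List ℕ) := [[1, 2, 3, 4, 5, 6, 7], [2, 2, 3, 4, 5, 6, 7], [3, 2, 3, 4, 5, 6, 7], [3, 3, 3, 4, 5, 6, 7], [4, 2, 3, 4, 5, 6, 7], [4, 3, 3, 4, 5, 6, 7], [4, 4, 3, 4, 5, 6, 7], [4, 4, 4, 4, 5, 6, 7]]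
/-- patterns 8–15 -/
def tausC1 : List (List ℕ) := [[5, 2, 3, 4, 5, 6, 7], [5, 3, 3, 4, 5, 6, 7], [5, 4, 3, 4, 5, 6, 7], [5, 4, 4, 4, 5, 6, 7], [5, 5, 3, 4, 5, 6, 7], [5, 5, 4, 4, 5, 6, 7], [5, 5, 5, 4, 5, 6, 7], [5, 5, 5, 5, 5, 6, 7]]
/-- patterns 16–23 -/
def tausC2 : List (List ℕ) := [[6, 2, 3, 4, 5, 6, 7], [6, 3, 3, 4, 5, 6, 7], [6, 4, 3, 4, 5, 6, 7], [6, 4, 4, 4, 5, 6, 7], [6, 5, 3, 4, 5, 6, 7], [6, 5, 4, 4, 5, 6, 7], [6, 5, 5, 4, 5, 6, 7], [6, 5, 5, 5, 5, 6, 7]]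
/-- patterns 24–31 -/
def tausC3 : List (List ℕ) := [[6, 6, 3, 4, 5, 6, 7], [6, 6, 4, 4, 5, 6, 7], [6, 6, 5, 4, 5, 6, 7], [6, 6, 5, 5, 5, 6, 7], [6, 6, 6, 4, 5, 6, 7], [6, 6, 6, 5, 5, 6, 7], [6, 6, 6, 6, 5, 6, 7], [6, 6, 6, 6, 6, 6, 7]]
/-- patterns 32–39 -/
def tausC4 : List (List ℕ) := [[7, 2, 3, 4, 5, 6, 7], [7, 3, 3, 4, 5, 6, 7], [7, 4, 3, 4, 5, 6, 7], [7, 4, 4, 4, 5, 6, 7], [7, 5, 3, 4, 5, 6, 7], [7, 5, 4, 4, 5, 6, 7], [7, 5, 5, 4, 5, 6, 7], [7, 5, 5, 5, 5, 6, 7]]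
/-- patterns 40–47 -/
def tausC5 : List (List ℕ) := [[7, 6, 3, 4, 5, 6, 7], [7, 6, 4, 4, 5, 6, 7], [7, 6, 5, 4, 5, 6, 7], [7, 6, 5, 5, 5, 6, 7], [7, 6, 6, 4, 5, 6, 7], [7, 6, 6, 5, 5, 6, 7], [7, 6, 6, 6, 5, 6, 7], [7, 6, 6, 6, 6, 6, 7]]
/-- patterns 48–55 -/
def tausC6 : List (List ℕ) := [[7, 7, 3, 4, 5, 6, 7], [7, 7, 4, 4, 5, 6, 7], [7, 7, 5, 4, 5, 6, 7], [7, 7, 5, 5, 5, 6, 7], [7, 7, 6, 4, 5, 6, 7], [7, 7, 6, 5, 5, 6, 7], [7, 7, 6, 6, 5, 6, 7], [7, 7, 6, 6, 6, 6, 7]]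
/-- patterns 56–63 -/
def tausC7 : List (List ℕ) := [[7, 7, 7, 4, 5, 6, 7], [7, 7, 7, 5, 5, 6, 7], [7, 7, 7, 6, 5, 6, 7], [7, 7, 7, 6, 6, 6, 7], [7, 7, 7, 7, 5, 6, 7], [7, 7, 7, 7, 6, 6, 7], [7, 7, 7, 7, 7, 6, 7], [7, 7, 7, 7, 7, 7, 7]]

/-- The 64 doubly-monotone (threshold) patterns on 7 ranks. -/
def taus64 : List (List ℕ) := tausC0 ++ tausC1 ++ tausC2 ++ tausC3 ++ tausC4 ++ tausC5 ++ tausC6 ++ tausC7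

/-! ### The computation -/

/-- Heavy pair of a pattern (symmetric; `false` on the diagonal): for `p < q`, heavy iff `τ[p] ≤ q`. -/
def heavy (τ : List ℕ) (p q : ℕ) : Bool :=
  if p < q then decide (τ.getD p 7 ≤ q) else if q < p then decide (τ.getD q 7 ≤ p) else false

/-- Number of marked consecutive pairs along a vertex sequence. -/
def hcount (hv : ℕ → ℕ → Bool) : List ℕ → ℕ
  | a :: b :: rest => (if hv a b then 1 else 0) + hcount hv (b :: rest)
  | _ => 0

/-- `W(P)`: marked consecutive pairs plus marked ends (`0` for the empty sequence). -/
def wVal (hv : ℕ → ℕ → Bool) (hi : ℕ → Bool) (P : List ℕ) : ℕ :=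
  hcount hv P + (match P.head? with | some a => if hi a then 1 else 0 | none => 0) +
    (match P.getLast? with | some b => if hi b then 1 else 0 | none => 0)

/-- All ways to pick one element of a list: pairs `(chosen, rest)`. -/
def picks : List ℕ → List (ℕ × List ℕ)
  | [] => []
  | a :: l => (a, l) :: (picks l).map fun br => (br.1, a :: br.2)

/-- All orderings of a list (structural recursion on a fuel argument `n = length`). -/
def perms : ℕ → List ℕ → List (List ℕ)
  | 0, _ => [[]]
  | n + 1, l => (picks l).flatMap fun ar => (perms n ar.2).map fun p => ar.1 :: p

/-- The interior vertices for the end pair `(a, b)`. -/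
def interior (a b : ℕ) : List ℕ := (List.range 7).filter fun v => v != a && v != b

/-- `(max, min)` of `hcount` over the Hamiltonian paths of `{0..6}` from `a` to `b`. -/
def endMaxMin (hv : ℕ → ℕ → Bool) (a b : ℕ) : ℕ × ℕ :=
  (perms 5 (interior a b)).foldl (fun acc mid => (max acc.1 (hcount hv (a :: (mid ++ [b]))),
    min acc.2 (hcount hv (a :: (mid ++ [b]))))) (0, 6)

/-- Table of `(a, b, hmax, hmin)` over end pairs `a < b < 7`. -/
def endTable (hv : ℕ → ℕ → Bool) : List (ℕ × ℕ × ℕ × ℕ) :=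
  (List.range 7).flatMap fun a => ((List.range 7).filter fun b => a < b).map fun b =>
    (a, b, (endMaxMin hv a b).1, (endMaxMin hv a b).2)

/-- The end bonus of the pair `(a, b)` for the high set `{v | 7 ≤ v + k}`. -/
def endBonus (k a b : ℕ) : ℕ := (if 7 ≤ a + k then 1 else 0) + (if 7 ≤ b + k then 1 else 0)

/-- Upper bound for `max_P W`. -/
def maxW (tbl : List (ℕ × ℕ × ℕ × ℕ)) (k : ℕ) : ℕ :=
  tbl.foldl (fun acc e => max acc (e.2.2.1 + endBonus k e.1 e.2.1)) 0

/-- Lower bound for `min_P W`. -/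
def minW (tbl : List (ℕ × ℕ × ℕ × ℕ)) (k : ℕ) : ℕ :=
  tbl.foldl (fun acc e => min acc (e.2.2.2 + endBonus k e.1 e.2.1)) 100

/-- The spread check for one pattern and all `k = 0..7`. -/
def checkTau (τ : List ℕ) : Bool :=
  (List.range 8).all fun k => decide (maxW (endTable (heavy τ)) k ≤ minW (endTable (heavy τ)) k + 5)

/-! ### The kernel certificate (eight chunks; one chunk of 64 exceeds the kernel budget) -/

set_option maxHeartbeats 4000000 in
/-- chunk 0 -/ theorem chunk0 : tausC0.all checkTau = true := by decide +kernel
set_option maxHeartbeats 4000000 in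
/-- chunk 1 -/ theorem chunk1 : tausC1.all checkTau = true := by decide +kernel
set_option maxHeartbeats 4000000 in
/-- chunk 2 -/ theorem chunk2 : tausC2.all checkTau = true := by decide +kernel
set_option maxHeartbeats 4000000 in
/-- chunk 3 -/ theorem chunk3 : tausC3.all checkTau = true := by decide +kernel
set_option maxHeartbeats 4000000 in
/-- chunk 4 -/ theorem chunk4 : tausC4.all checkTau = true := by decide +kernel
set_option maxHeartbeats 4000000 in
/-- chunk 5 -/ theorem chunk5 : tausC5.all checkTau = true := by decide +kernel
set_option maxHeartbeats 4000000 in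
/-- chunk 6 -/ theorem chunk6 : tausC6.all checkTau = true := by decide +kernel
set_option maxHeartbeats 4000000 in
/-- chunk 7 -/ theorem chunk7 : tausC7.all checkTau = true := by decide +kernel

/-- **Every pattern of `taus64` passes the spread check.** -/
theorem checkTau_of_mem_taus64 {τ : List ℕ} (h : τ ∈ taus64) : checkTau τ = true := by
  have hall : taus64.all checkTau = true := by
    simp only [taus64, List.all_append, chunk0, chunk1, chunk2, chunk3, chunk4, chunk5, chunk6, chunk7,
      Bool.and_self]
  exact List.all_eq_true.mp hall τ h

/-! ### Correctness of the enumeration -/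

/-- Specification of `picks`. -/
theorem mem_picks_iff {l : List ℕ} {a : ℕ} {r : List ℕ} :
    (a, r) ∈ picks l ↔ ∃ l₁ l₂, l = l₁ ++ a :: l₂ ∧ r = l₁ ++ l₂ := by
  induction l generalizing a r with
  | nil => simp [picks]
  | cons x l ih =>
    simp only [picks, List.mem_cons, Prod.mk.injEq, List.mem_map, Prod.exists]
    constructor
    · rintro (⟨ha, hr⟩ | ⟨b, r', hm, hb, hr⟩)
      · exact ⟨[], l, by simp [ha], by simp [hr]⟩
      · subst hb; subst hr
        obtain ⟨l₁, l₂, h1, h2⟩ := ih.mp hm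
        exact ⟨x :: l₁, l₂, by simp [h1], by simp [h2]⟩
    · rintro ⟨l₁, l₂, h1, h2⟩
      rcases l₁ with _ | ⟨y, l₁⟩
      · left; simp at h1; exact ⟨h1.1.symm, by simp [h2, h1.2]⟩
      · right
        simp only [List.cons_append, List.cons.injEq] at h1
        obtain ⟨rfl, rfl⟩ := h1
        exact ⟨a, l₁ ++ l₂, ih.mpr ⟨l₁, l₂, rfl, rfl⟩, rfl, by simp [h2]⟩

/-- **Completeness of `perms`**: every permutation of `l` is enumerated by `perms l.length l`. -/
theorem perms_complete : ∀ (n : ℕ) (l m : List ℕ), l.length = n → m.Perm l → m ∈ perms n l := by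
  intro n
  induction n with
  | zero =>
    intro l m hl hm
    have : m = [] := List.eq_nil_of_length_eq_zero (by rw [hm.length_eq, hl])
    subst this; simp [perms]
  | succ n ih =>
    intro l m hl hm
    obtain ⟨a, m', rfl⟩ : ∃ a m', m = a :: m' := by
      rcases m with _ | ⟨a, m'⟩
      · simp [← hm.length_eq] at hl
      · exact ⟨a, m', rfl⟩
    have ha : a ∈ l := hm.subset (List.mem_cons_self ..)
    obtain ⟨l₁, l₂, rfl⟩ := List.append_of_mem ha
    have hm' : m'.Perm (l₁ ++ l₂) := (hm.trans List.perm_middle).cons_inv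
    have hlen : (l₁ ++ l₂).length = n := by
      simp only [List.length_append, List.length_cons] at hl ⊢; omega
    simp only [perms, List.mem_flatMap, List.mem_map, Prod.exists]
    exact ⟨a, l₁ ++ l₂, mem_picks_iff.mpr ⟨l₁, l₂, rfl, rfl⟩, m', ih _ _ hlen hm', rfl⟩

/-! ### Correctness of the folds -/

/-- The `(max, min)` fold brackets every value and is monotone in the accumulator. -/
theorem foldl_maxmin_spec (f : List ℕ → ℕ) :
    ∀ (L : List (List ℕ)) (acc : ℕ × ℕ),
      (L.foldl (fun acc mid => (max acc.1 (f mid), min acc.2 (f mid))) acc).2 ≤ acc.2 ∧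
      acc.1 ≤ (L.foldl (fun acc mid => (max acc.1 (f mid), min acc.2 (f mid))) acc).1 ∧
      ∀ x ∈ L, (L.foldl (fun acc mid => (max acc.1 (f mid), min acc.2 (f mid))) acc).2 ≤ f x ∧
        f x ≤ (L.foldl (fun acc mid => (max acc.1 (f mid), min acc.2 (f mid))) acc).1 := by
  intro L
  induction L with
  | nil => intro acc; simp
  | cons y L ih =>
    intro acc
    simp only [List.foldl_cons, List.mem_cons]
    obtain ⟨h2, h1, hx⟩ := ih (max acc.1 (f y), min acc.2 (f y))
    refine ⟨le_trans h2 (min_le_left _ _), le_trans (le_max_left _ _) h1, ?_⟩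
    rintro x (rfl | hxL)
    · exact ⟨le_trans h2 (min_le_right _ _), le_trans (le_max_right _ _) h1⟩
    · exact hx x hxL

/-- A `max`-fold dominates every member value. -/
theorem le_foldl_max {α : Type*} (g : α → ℕ) : ∀ (L : List α) (acc : ℕ),
    acc ≤ L.foldl (fun acc e => max acc (g e)) acc ∧ ∀ e ∈ L, g e ≤ L.foldl (fun acc e => max acc (g e)) acc := by
  intro L
  induction L with
  | nil => intro acc; simp
  | cons y L ih =>
    intro acc
    simp only [List.foldl_cons, List.mem_cons]
    obtain ⟨h1, h2⟩ := ih (max acc (g y))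
    refine ⟨le_trans (le_max_left _ _) h1, fun e he => ?_⟩
    rcases he with rfl | he
    exacts [le_trans (le_max_right _ _) h1, h2 e he]

/-- A `min`-fold is below every member value. -/
theorem foldl_min_le {α : Type*} (g : α → ℕ) : ∀ (L : List α) (acc : ℕ),
    L.foldl (fun acc e => min acc (g e)) acc ≤ acc ∧ ∀ e ∈ L, L.foldl (fun acc e => min acc (g e)) acc ≤ g e := by
  intro L
  induction L with
  | nil => intro acc; simp
  | cons y L ih =>
    intro acc
    simp only [List.foldl_cons, List.mem_cons]
    obtain ⟨h1, h2⟩ := ih (min acc (g y))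
    refine ⟨le_trans h1 (min_le_left _ _), fun e he => ?_⟩
    rcases he with rfl | he
    exacts [le_trans h1 (min_le_right _ _), h2 e he]

/-- The table bounds: for `a < b < 7` and an interior ordering `mid`, the path `a :: mid ++ [b]` has its `hcount`
between the table's `hmin` and `hmax`, hence its `W` between `minW` and `maxW`. -/
theorem wVal_mem_bounds (hv : ℕ → ℕ → Bool) (k a b : ℕ) (hab : a < b) (hb : b < 7) (mid : List ℕ)
    (hmid : mid.Perm (interior a b)) :
    minW (endTable hv) k ≤ hcount hv (a :: (mid ++ [b])) + endBonus k a b ∧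
      hcount hv (a :: (mid ++ [b])) + endBonus k a b ≤ maxW (endTable hv) k := by
  have hlen : (interior a b).length = 5 := by
    have ha : a < 7 := lt_trans hab hb
    simp only [interior]
    interval_cases b <;> interval_cases a <;> decide
  have hmem : mid ∈ perms 5 (interior a b) := perms_complete 5 _ _ hlen hmid
  obtain ⟨-, -, hx⟩ := foldl_maxmin_spec (fun mid => hcount hv (a :: (mid ++ [b]))) (perms 5 (interior a b)) (0, 6)
  obtain ⟨hlo, hhi⟩ := hx mid hmem
  have he : (a, b, (endMaxMin hv a b).1, (endMaxMin hv a b).2) ∈ endTable hv := by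
    simp only [endTable, List.mem_flatMap, List.mem_map, List.mem_filter, List.mem_range, decide_eq_true_eq]
    exact ⟨a, lt_trans hab hb, b, ⟨hb, hab⟩, rfl⟩
  have hlo' : (endMaxMin hv a b).2 ≤ hcount hv (a :: (mid ++ [b])) := hlo
  have hhi' : hcount hv (a :: (mid ++ [b])) ≤ (endMaxMin hv a b).1 := hhi
  constructor
  · have := (foldl_min_le (fun e : ℕ × ℕ × ℕ × ℕ => e.2.2.2 + endBonus k e.1 e.2.1) (endTable hv) 100).2 _ he
    unfold minW
    exact le_trans this (by simp only; omega)
  · have := (le_foldl_max (fun e : ℕ × ℕ × ℕ × ℕ => e.2.2.1 + endBonus k e.1 e.2.1) (endTable hv) 0).2 _ he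
    unfold maxW
    exact le_trans (by simp only; omega) this

/-! ### Every Hamiltonian path is `a :: mid ++ [b]`, up to reversal with `a < b` -/

/-- `hcount` of an appended singleton. -/
theorem hcount_append_singleton (hv : ℕ → ℕ → Bool) : ∀ (l : List ℕ) (x y : ℕ),
    hcount hv (l ++ [x] ++ [y]) = hcount hv (l ++ [x]) + (if hv x y then 1 else 0) := by
  intro l
  induction l with
  | nil => intro x y; simp [hcount]
  | cons z l ih =>
    intro x y
    rcases l with _ | ⟨w, l⟩
    · simp [hcount]
    · have := ih x y
      simp only [List.cons_append] at this ⊢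
      simp only [hcount, this]
      omega

/-- **Reversal invariance** of `hcount` for a symmetric marking. -/
theorem hcount_reverse (hv : ℕ → ℕ → Bool) (hsym : ∀ p q, hv p q = hv q p) :
    ∀ l : List ℕ, hcount hv l.reverse = hcount hv l := by
  intro l
  induction l with
  | nil => simp [hcount]
  | cons a l ih =>
    rcases l with _ | ⟨b, l⟩
    · simp [hcount]
    · rw [List.reverse_cons, List.reverse_cons, hcount_append_singleton, ← List.reverse_cons, ih, hsym b a]
      simp only [hcount]
      omega

/-- `W` is reversal invariant for a symmetric marking. -/
theorem wVal_reverse (hv : ℕ → ℕ → Bool) (hi : ℕ → Bool) (hsym : ∀ p q, hv p q = hv q p) (l : List ℕ) :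
    wVal hv hi l.reverse = wVal hv hi l := by
  unfold wVal
  rw [hcount_reverse hv hsym, List.head?_reverse, List.getLast?_reverse]
  omega

/-- `W` of a path written as `a :: mid ++ [b]`. -/
theorem wVal_cons_append (hv : ℕ → ℕ → Bool) (k a b : ℕ) (mid : List ℕ) :
    wVal hv (fun v => decide (7 ≤ v + k)) (a :: (mid ++ [b])) = hcount hv (a :: (mid ++ [b])) + endBonus k a b := by
  unfold wVal endBonus
  have h1 : (a :: (mid ++ [b])).head? = some a := rfl
  have h2 : (a :: (mid ++ [b])).getLast? = some b := by
    rw [← List.cons_append, List.getLast?_append]; simp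
  rw [h1, h2]
  simp only [decide_eq_true_eq]
  split_ifs <;> omega

/-- Decomposition of an ordering of `range 7` with increasing ends. -/
theorem exists_decomp {P : List ℕ} (hP : P.Perm (List.range 7)) :
    ∃ a b mid, P = a :: (mid ++ [b]) ∧ a ≠ b ∧ a < 7 ∧ b < 7 ∧ mid.Perm (interior a b) := by
  have hnd : P.Nodup := hP.nodup_iff.mpr (List.nodup_range)
  have hlen : P.length = 7 := by rw [hP.length_eq, List.length_range]
  obtain ⟨a, rest, rfl⟩ : ∃ a rest, P = a :: rest := by
    rcases P with _ | ⟨a, rest⟩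
    · simp at hlen
    · exact ⟨a, rest, rfl⟩
  have hrest : rest ≠ [] := by rintro rfl; simp at hlen
  obtain ⟨mid, b, hmb⟩ : ∃ mid b, rest = mid ++ [b] :=
    ⟨rest.dropLast, rest.getLast hrest, (List.dropLast_append_getLast hrest).symm⟩
  subst hmb
  have hmem : ∀ x, x ∈ a :: (mid ++ [b]) ↔ x < 7 := fun x => by rw [hP.mem_iff, List.mem_range]
  have ha : a < 7 := (hmem a).mp (by simp)
  have hb : b < 7 := (hmem b).mp (by simp)
  have hab : a ≠ b := by
    intro h; subst h
    rw [List.nodup_cons] at hnd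
    exact hnd.1 (by simp)
  refine ⟨a, b, mid, rfl, hab, ha, hb, ?_⟩
  rw [List.nodup_cons] at hnd
  obtain ⟨hna, hnd2⟩ := hnd
  rw [List.nodup_append] at hnd2
  obtain ⟨hndmid, -, hdisj⟩ := hnd2
  apply (List.perm_ext_iff_of_nodup hndmid (List.nodup_range.filter _)).mpr
  intro x
  simp only [List.mem_filter, List.mem_range, Bool.and_eq_true, bne_iff_ne, ne_eq]
  constructor
  · intro hx
    refine ⟨(hmem x).mp (by simp [hx]), ?_, ?_⟩
    · rintro rfl; exact hna (by simp [hx])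
    · rintro rfl; exact hdisj x hx x (by simp) rfl
  · rintro ⟨hx7, hxa, hxb⟩
    have := (hmem x).mpr hx7
    simp only [List.mem_cons, List.mem_append, List.not_mem_nil, or_false] at this
    rcases this with h | h | h
    · exact absurd h hxa
    · exact h
    · exact absurd h hxb

/-- The interior does not depend on the order of the end pair. -/
theorem interior_comm (a b : ℕ) : interior b a = interior a b :=
  List.filter_congr fun x _ => by rw [Bool.and_comm]

/-- `heavy τ` is symmetric. -/
theorem heavy_symm (τ : List ℕ) (p q : ℕ) : heavy τ p q = heavy τ q p := by
  unfold heavy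
  rcases lt_trichotomy p q with h | rfl | h
  · rw [if_pos h, if_neg (lt_asymm h), if_pos h]
  · simp
  · rw [if_neg (lt_asymm h), if_pos h, if_pos h]

/-- **Main finite statement.** If `checkTau τ` holds then, for every `k ≤ 7` and all orderings `P, P'` of `{0..6}`,
`W(P) ≤ W(P') + 5` for the marking `heavy τ` and the high set `{v | 7 ≤ v + k}`. -/
theorem wVal_sub_le_five_of_checkTau {τ : List ℕ} (hτ : checkTau τ = true) {k : ℕ} (hk : k ≤ 7) {P P' : List ℕ}
    (hP : P.Perm (List.range 7)) (hP' : P'.Perm (List.range 7)) :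
    wVal (heavy τ) (fun v => decide (7 ≤ v + k)) P ≤ wVal (heavy τ) (fun v => decide (7 ≤ v + k)) P' + 5 := by
  -- the check at this `k`
  have hcheck : maxW (endTable (heavy τ)) k ≤ minW (endTable (heavy τ)) k + 5 := by
    unfold checkTau at hτ
    have := List.all_eq_true.mp hτ k (List.mem_range.mpr (by omega))
    exact of_decide_eq_true this
  -- upper bound for `P`, lower bound for `P'`, each after reversing if necessary
  have upper : ∀ Q : List ℕ, Q.Perm (List.range 7) →
      wVal (heavy τ) (fun v => decide (7 ≤ v + k)) Q ≤ maxW (endTable (heavy τ)) k ∧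
      minW (endTable (heavy τ)) k ≤ wVal (heavy τ) (fun v => decide (7 ≤ v + k)) Q := by
    intro Q hQ
    obtain ⟨a, b, mid, rfl, hab, ha, hb, hmid⟩ := exists_decomp hQ
    rcases lt_or_gt_of_ne hab with h | h
    · rw [wVal_cons_append]
      have := wVal_mem_bounds (heavy τ) k a b h hb mid hmid
      exact ⟨this.2, this.1⟩
    · -- reverse the path: `b :: mid.reverse ++ [a]` with `b < a`
      have hrev : (a :: (mid ++ [b])).reverse = b :: (mid.reverse ++ [a]) := by simp
      rw [← wVal_reverse (heavy τ) _ (heavy_symm τ), hrev, wVal_cons_append]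
      have hmid' : mid.reverse.Perm (interior b a) := by
        rw [interior_comm]; exact (List.reverse_perm mid).trans hmid
      have := wVal_mem_bounds (heavy τ) k b a h ha mid.reverse hmid'
      exact ⟨this.2, this.1⟩
  have h1 := (upper P hP).1
  have h2 := (upper P' hP').2
  omega

end Summit.KontsevichZagierPeriods.Zeta5Search.Barrier.ConeGamma.NCap
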